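import Summits.Ventures.CertifiedArithmetic.LowPrec.GemmQuarterRounding

/-!
# Round-to-nearest-even into `bfloat16` on a dyadic grid `2^-g ℤ`, by small-integer arithmetic

HONEST FRAMING (venture CertifiedArithmetic / cell `pub-lowprec`, seat gemm, gen 7): certified error
envelopes and provably optimal rounding/accumulation schemes for low-precision formats under stated
cost models; every table by two implementations; no hardware or vendor claims.

Purpose: `GemmQuarterRounding.lean` proved `fl_bf16(K/4) = rneQuarter K / 4` for `|K| < 2^32`; the
integer function `rneQuarter` (RNE to 8 significant bits of an integer) is grid-agnostic, and this
file proves the same bridge on every grid `2^-g` with `g ≤ 133` (the quantum exponent of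
`bfloat16` is `-133`): `toRat_roundNE_BFloat16_dyadic`.  The finite certificates for the E3M2² products
(grid `2^-8`, magnitudes below `2^27`) and the E2M3² products (grid `2^-6`) of `gemm.tex` §Regimes
are checked in the kernel through it (`GemmThetaE3M2*.lean`).  Nothing here is specific to gemm.
-/

namespace Literature.ComputerArithmetic.FloatingPoint

namespace MiniFloat

open Format

/-- Integers below `256` in magnitude, read in units `2^-g` with `g ≤ 133`, are `bfloat16` values.
[folklore] -/
theorem exists_toRat_eq_BFloat16_dyadic {g : ℕ} (hg : g ≤ 133) {K : ℤ} (hK : K.natAbs < 256) :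
    ∃ y : MiniFloat Format.BFloat16, y.toRat = (K : ℚ) / 2 ^ g := by
  have h2g : (0 : ℚ) < 2 ^ g := by positivity
  refine exists_toRat_eq_of_isFloat ⟨K, -(g : ℤ), ?_, by rw [BFloat16_qexp]; omega, ?_⟩ ?_
  · rw [BFloat16_manBits]; norm_num; rw [← Int.natCast_natAbs]; exact_mod_cast hK
  · rw [zpow_neg, zpow_natCast]; ring
  · rw [BFloat16_maxRat.1, abs_div, abs_of_pos h2g, ← Int.cast_abs, ← Nat.cast_natAbs]
    have hlt : ((K.natAbs : ℕ) : ℚ) < 256 := by exact_mod_cast hK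
    have h1 : (1 : ℚ) ≤ 2 ^ g := one_le_pow₀ (by norm_num)
    calc ((K.natAbs : ℕ) : ℚ) / 2 ^ g ≤ (K.natAbs : ℕ) := div_le_self (by positivity) h1
      _ ≤ (2 ^ 8 - 1) * 2 ^ 120 := by norm_num at hlt ⊢; linarith

/-- THE BRIDGE on the grid `2^-g`, `g ≤ 133`: below `2^32` grid units,
`fl_bf16(K / 2^g) = rneQuarter K / 2^g`. [folklore; closed form `Format.rneGrid_of_pattern`] -/
theorem toRat_roundNE_BFloat16_dyadic {g : ℕ} (hg : g ≤ 133) (K : ℤ) (hK : K.natAbs < 2 ^ 32) :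
    (roundNE Format.BFloat16 ((K : ℚ) / 2 ^ g)).toRat = (rneQuarter K : ℚ) / 2 ^ g := by
  have h2g : (0 : ℚ) < 2 ^ g := by positivity
  have habs : |(K : ℚ) / 2 ^ g| = (K.natAbs : ℚ) / 2 ^ g := by
    rw [abs_div, abs_of_pos h2g, Nat.cast_natAbs, Int.cast_abs]
  have hsgn : (K : ℚ) / 2 ^ g < 0 ↔ K < 0 := by
    rw [div_lt_iff₀ h2g, zero_mul]; norm_cast
  by_cases hn : K.natAbs < 256
  · -- exact branch
    rw [toRat_roundNE_of_exists (exists_toRat_eq_BFloat16_dyadic hg hn)]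
    unfold rneQuarter rneQuarterMag
    rw [if_pos hn]
    have : (if K < 0 then -((K.natAbs : ℕ) : ℤ) else ((K.natAbs : ℕ) : ℤ)) = K := by
      split_ifs with h <;> omega
    rw [this]
  · -- pattern branch
    set k := quarterShift K.natAbs 24 with hk
    set d := 133 - g with hd
    obtain ⟨hlo, hhi⟩ := quarterShift_spec 24 K.natAbs (not_lt.mp hn) hK
    have hq2 : Format.BFloat16.quantum = 1 / 2 ^ 133 := BFloat16_maxRat.2
    have h133 : (2 : ℚ) ^ 133 = 2 ^ d * 2 ^ g := by rw [← pow_add, hd, Nat.sub_add_cancel hg]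
    have hx : |(K : ℚ) / 2 ^ g|
        = (K.natAbs : ℚ) * 2 ^ (d + k) / 2 ^ k * Format.BFloat16.quantum := by
      rw [habs, hq2, h133, pow_add]; field_simp
    have hmax : |(K : ℚ) / 2 ^ g| ≤ Format.BFloat16.maxRat := by
      rw [habs, BFloat16_maxRat.1]
      have hlt : ((K.natAbs : ℕ) : ℚ) < 2 ^ 32 := by exact_mod_cast hK
      have h1 : (1 : ℚ) ≤ 2 ^ g := one_le_pow₀ (by norm_num)
      calc ((K.natAbs : ℕ) : ℚ) / 2 ^ g ≤ (K.natAbs : ℕ) := div_le_self (by positivity) h1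
        _ ≤ (2 ^ 8 - 1) * 2 ^ 120 := by norm_num at hlt ⊢; linarith
    have hlo' : 2 ^ (Format.BFloat16.manBits + k) ≤ K.natAbs := by rw [BFloat16_manBits]; exact hlo
    have hhi' : K.natAbs < 2 ^ (Format.BFloat16.manBits + k + 1) := by rw [BFloat16_manBits]; exact hhi
    have hgrid := Format.rneGrid_of_pattern hlo' hhi' (pattern_le_maxScaled hx hmax)
    rw [rneInt_natCast_div_two_pow, Int.cast_natCast] at hgrid
    rw [toRat_roundNE, scaledInput_of_pattern hx]
    unfold rneQuarter rneQuarterMag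
    rw [if_neg hn, ← hk]
    simp only [hsgn]
    split_ifs with hneg
    · rw [neg_mul, hgrid, hq2, h133]; push_cast; rw [pow_add]; field_simp
    · rw [hgrid, hq2, h133]; push_cast; rw [pow_add]; field_simp

/-- A grid value `(rneQuarter K)/2^g` is a `bfloat16` value (it is a rounding). [folklore] -/
theorem exists_toRat_eq_rneQuarter_dyadic {g : ℕ} (hg : g ≤ 133) (K : ℤ) (hK : K.natAbs < 2 ^ 32) :
    ∃ y : MiniFloat Format.BFloat16, y.toRat = (rneQuarter K : ℚ) / 2 ^ g :=
  ⟨_, toRat_roundNE_BFloat16_dyadic hg K hK⟩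

end MiniFloat

end Literature.ComputerArithmetic.FloatingPoint
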